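/-
Copyright (c) 2026. All rights reserved.
Released under Apache 2.0 license as described in the file LICENSE.
-/
import Literature.AlgebraicGeometry.Pohlmann1968.CMTypeRankTwo
import Literature.NumberTheory.ComplexMultiplication.SiegelCMPointsIsogenyClassCount
import HarnessLib

/-!
# Rank `3`: the abelian varieties of a rank-`3` CM type are isogenous to powers of simple CM abelian SURFACES, and
# satisfy the Hodge conjecture with all their powers — over any CM field

SETTING.  `K` a CM field (any — not assumed Galois), `Φ` a CM type of `K`, `Rank(Φ) = cmTypeRank Φ` its
Kubota–Dodson rank (the dimension of the Mumford–Tate group of any abelian variety of type `(K; Φ)`), `K* ⊂ ℂ`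
Shimura's reflex field (tree `traceField`).  The tree knows Ribet's inequalities `⌈log₂ 2[K* : ℚ]⌉ ≤ Rank(Φ) ≤
[K* : ℚ]/2 + 1` ([Ribet1980] §3 (3.4)–(3.5); tree `CMTypeRankReflexDegreeComplex`), whence
`Rank(Φ) = 3 ⟺ [K* : ℚ] = 4 ⟺` the PRIMITIVE CORE of `Φ` is a QUARTIC field
(`cmTypeRank_eq_three_iff_exists_quartic_core`), and the rank-`2` story (`CMTypeRankTwo`: `Rank = 2 ⟺` induced from
an imaginary quadratic subfield `⟹` Hodge conjecture for all powers).  THIS FILE does rank `3`: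

> **Theorem** (`cmTypeRank_eq_three_iff_exists_quartic_isNondegenerate`).  `Rank(Φ) = 3` iff `Φ = Φ₁^K` is induced
> from a NONDEGENERATE CM type `Φ₁` of a QUARTIC CM subfield `K₁ ⊆ K` (rank is invariant under induction, Shimura
> §32.9, and `3 = 4/2 + 1` is the nondegenerate rank in degree `4`).
> **Theorem** (`hodgeClassSpan_pow_eq_divisorClassesSpan_of_cmTypeRank_eq_three`,
> `hodgeConjectureFor_pow_of_cmTypeRank_eq_three`).  For EVERY abelian variety `A` of a rank-`3` CM type over ANY CM
> field: `Bᵐ(Aⁿ) ⊗ ℂ = Dᵐ(Aⁿ) ⊗ ℂ` for all `n, m` (Pohlmann–Hazama transfer along `Φ = Φ₁^K`, tree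
> `IsNondegenerate.hodgeClassSpan_pow_eq_divisorClassesSpan_inducedCMType`), hence THE HODGE CONJECTURE FOR ALL POWERS
> `Aⁿ`; no power carries an exceptional Hodge class.  With `CMTypeRankTwo`: **`Rank(Φ) ≤ 3 ⟹` Hodge conjecture for
> all powers** (`hodgeConjectureFor_pow_of_cmTypeRank_le_three`); equivalently `[K* : ℚ] = 4`
> (`hodgeConjectureFor_pow_of_finrank_traceField_eq_four`).
> **Theorem** (`not_isSimple_of_cmTypeRank_eq_three`, `cmTypeRank_eq_three_iff_finrank_eq_four_of_isSimple`).  For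
> `[K:ℚ] > 4` these abelian varieties are NOT simple (`A ∼ S^{[K:ℚ]/4}`, `S` a simple CM abelian surface); a simple `A`
> has `Rank = 3` iff `dim A = 2`.

So the first rank at which exceptional Hodge classes occur is `4` (Mumford–Pohlmann: the degenerate octic types of
rank `4`, tree `MumfordSimpleFourfold`; for ABELIAN `K` the tree's `AbelianCMFieldSurvivorClosureCriterion` reads
`B = D` on `A` as `[K* : ℚ] = 2(Rank − 1)`, which for rank `3` is Ribet's `[K* : ℚ] = 4`).

* §1 `exists_quartic_isNondegenerate_of_cmTypeRank_eq_three`, **`cmTypeRank_eq_three_iff_exists_quartic_isNondegenerate`**,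
  `four_le_finrank_of_cmTypeRank_eq_three`, `four_dvd_finrank_of_cmTypeRank_eq_three`,
  `not_isPrimitive_of_cmTypeRank_eq_three`, **`not_isSimple_of_cmTypeRank_eq_three`**,
  `finrank_eq_four_of_isSimple_of_cmTypeRank_eq_three`, **`cmTypeRank_eq_three_iff_finrank_eq_four_of_isSimple`**.
* §2 **`hodgeClassSpan_pow_eq_divisorClassesSpan_of_cmTypeRank_eq_three`**, **`hodgeConjectureFor_pow_of_cmTypeRank_eq_three`**,
  `hodgeClasses_algebraic_pow_of_cmTypeRank_eq_three`, `not_exists_exceptional_pow_of_cmTypeRank_eq_three`,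
  **`hodgeConjectureFor_pow_of_cmTypeRank_le_three`**, `hodgeClassSpan_pow_eq_divisorClassesSpan_of_cmTypeRank_le_three`,
  `hodgeConjectureFor_pow_of_finrank_traceField_eq_four`.

HONEST SCOPE.  Assembly of tree theorems (Ribet's inequalities and the quartic core, rank invariance under induction,
the Pohlmann–Hazama transfer for induced nondegenerate types, Shimura's simple ⟺ primitive); the sources print those
and the rank-`3` ⟺ `n* = 4` line of Ribet's/Dodson's tables; «Hodge conjecture for all powers of rank-`3` CM abelian
varieties» is this file's packaging of Gordon's Thm. 6.4 (⟸) for them.  THEOREMS ONLY: no definition, no named fact,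
no instance, no `sorry`.

## References

* [Ribet1980] K. A. Ribet, *Division fields of abelian varieties with complex multiplication*, Mém. SMF 2 (1980),
  §3 (3.4)–(3.5), Examples (3.7) (pp. 86–87).
* [Dodson1987] B. Dodson, *On the Mumford–Tate group of an abelian variety with complex multiplication*, J. Algebra
  111 (1987), Thm. 1.0, §1.1.
* [Gordon1999HodgeAVSurvey] B. B. Gordon, *A survey of the Hodge conjecture for abelian varieties*, Thm. 6.4, §9.3.
* [Shimura1998] G. Shimura, *Abelian Varieties with Complex Multiplication and Modular Functions*, §8.2 Prop. 26,
  §8.4 Example (2), §32.9.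
* [Streng2010] M. Streng, *Complex multiplication of abelian surfaces*, thesis, Leiden (2010), Ch. I Lemma 3.4–3.5.
* [Pohlmann1968] H. Pohlmann, *Algebraic cycles on abelian varieties of complex multiplication type*, Ann. of Math. 88
  (1968), Thm. 1.

## Provenance

Lane `lit-hodgefound` (Track 2, Layer A5), seat `lit-hodgefound-p10` generation 40, row g40-#3; neighbours cited by
name, nothing restated: `CMTypeRankTwo` (the rank-`2` half), `CMTypeRankReflexDegreeComplex`
(`cmTypeRank_eq_three_iff_exists_quartic_core`, `cmTypeRank_eq_three_iff_finrank_traceField_eq_four`,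
`two_le_cmTypeRank_complex`, `three_le_cmTypeRank_of_isPrimitive`), `CMTypeRankInducedType` (`cmTypeRank_inducedCMType`),
`NonSimpleCMAbelianVarietyHazamaCriterion` (`IsNondegenerate.hodgeClassSpan_pow_eq_divisorClassesSpan_inducedCMType`),
`NondegenerateCMTypeHodgeConjecture` (`isNondegenerate_of_isPrimitive_of_prime`), `NondegenerateCMTypeDivisorClasses`
(`isNondegenerate_iff`), `SimpleIffPrimitiveCMType` (`isSimple_iff_isPrimitive`), `SiegelCMPointsIsogenyClassCount`
(`SiegelCMPoint.not_exists_inducedCMType_iff_isPrimitive`).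
-/

open scoped BigOperators NumberField Classical
open NumberField Module CategoryTheory CategoryTheory.Limits IntermediateField

namespace Literature.AlgebraicGeometry.Pohlmann1968

-- `open scoped`: the tree's action of `Aut(ℂ)` on `Hom(K, ℂ)` by composition is a scoped instance
open scoped Literature.NumberTheory.ComplexMultiplication
open Literature.NumberTheory.ComplexMultiplication (IsPrimitive inducedCMType isCMField_of_cmType_intermediateField
  traceField cmTypeRank_eq_three_iff_exists_quartic_core cmTypeRank_eq_three_iff_finrank_traceField_eq_four
  two_le_cmTypeRank_complex three_le_cmTypeRank_of_isPrimitive)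
open Literature.NumberTheory.ComplexMultiplication.SiegelCMPoint (not_exists_inducedCMType_iff_isPrimitive)
open Literature.AlgebraicGeometry.Motives (CMType AbelianVariety)
open Literature.AlgebraicGeometry.HodgeTheory
open Literature.AlgebraicGeometry.VanGeemen1994 (hodgeClassSpan)
open Literature.Barriers.HodgeConjecture (divisorClassesSpan)
open Literature.AlgebraicGeometry.ComplexMultiplication (IsCMTypeRealisation isSimple_iff_isPrimitive)

variable {K : Type} [Field K] [NumberField K] [IsCMField K]
  {A : AbelianVariety ℂ} {ι : 𝓞 K →+* End A} {θ : K →+* Module.End ℂ (complexBetti A.X 1)}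

/-! ## §1 Rank `3` ⟺ induced from a nondegenerate type of a quartic CM subfield -/

section Structure

/-- **`Rank(Φ) = 3 ⟹ Φ = Φ₁^K` with `Φ₁` a NONDEGENERATE CM type of a QUARTIC CM subfield `K₁ ⊆ K`** (the primitive
core is quartic, tree `cmTypeRank_eq_three_iff_exists_quartic_core`; `Rank(Φ₁) = Rank(Φ₁^K) = 3 = 4/2 + 1`, Shimura
§32.9). [cite: Ribet1980, §3 (3.4)–(3.5)] [cite: Shimura1998, §32.9 and §8.4 Example (2)] -/
theorem exists_quartic_isNondegenerate_of_cmTypeRank_eq_three (Φ : CMType K) (hr : cmTypeRank Φ = 3) :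
    ∃ (K₁ : IntermediateField ℚ K) (Φ₁ : CMType K₁), finrank ℚ K₁ = 4 ∧
      inducedCMType (algebraMap K₁ K) Φ₁ = Φ ∧ IsNondegenerate Φ₁ := by
  obtain ⟨K₁, Φ₁, h4, hΦ, -⟩ := (cmTypeRank_eq_three_iff_exists_quartic_core Φ).1 hr
  haveI : IsCMField K₁ := isCMField_of_cmType_intermediateField K₁ Φ₁
  refine ⟨K₁, Φ₁, h4, hΦ, (isNondegenerate_iff Φ₁).2 ?_⟩
  rw [← cmTypeRank_inducedCMType (algebraMap K₁ K) Φ₁, hΦ, hr, h4]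

/-- **`Rank(Φ) = 3 ⟺ Φ` is induced from a NONDEGENERATE CM type of a QUARTIC CM subfield.**
[cite: Ribet1980, §3 (3.4)–(3.5)] [cite: Shimura1998, §32.9] [cite: Dodson1987, Thm. 1.0] -/
theorem cmTypeRank_eq_three_iff_exists_quartic_isNondegenerate (Φ : CMType K) :
    cmTypeRank Φ = 3 ↔
      ∃ (K₁ : IntermediateField ℚ K) (Φ₁ : CMType K₁), finrank ℚ K₁ = 4 ∧
        inducedCMType (algebraMap K₁ K) Φ₁ = Φ ∧ IsNondegenerate Φ₁ := by
  refine ⟨exists_quartic_isNondegenerate_of_cmTypeRank_eq_three Φ, ?_⟩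
  rintro ⟨K₁, Φ₁, h4, hΦ, hnd⟩
  haveI : IsCMField K₁ := isCMField_of_cmType_intermediateField K₁ Φ₁
  rw [← hΦ, cmTypeRank_inducedCMType, (isNondegenerate_iff Φ₁).1 hnd, h4]

omit [IsCMField K] in
/-- The degree of an intermediate field divides the degree. [folklore] -/
private theorem finrank_dvd_of_intermediateField (K₁ : IntermediateField ℚ K) : finrank ℚ K₁ ∣ finrank ℚ K :=
  Dvd.intro _ (Module.finrank_mul_finrank ℚ K₁ K)

/-- **`Rank(Φ) = 3 ⟹ 4 ∣ [K:ℚ]`** (`K` contains the quartic core). [cite: Ribet1980, §3 (3.4)–(3.5)] -/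
theorem four_dvd_finrank_of_cmTypeRank_eq_three (Φ : CMType K) (hr : cmTypeRank Φ = 3) : 4 ∣ finrank ℚ K := by
  obtain ⟨K₁, Φ₁, h4, -, -⟩ := exists_quartic_isNondegenerate_of_cmTypeRank_eq_three Φ hr
  rw [← h4]
  exact finrank_dvd_of_intermediateField K₁

/-- **`Rank(Φ) = 3 ⟹ [K:ℚ] ≥ 4`.** [cite: Ribet1980, §3 (3.4)–(3.5)] -/
theorem four_le_finrank_of_cmTypeRank_eq_three (Φ : CMType K) (hr : cmTypeRank Φ = 3) : 4 ≤ finrank ℚ K :=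
  Nat.le_of_dvd finrank_pos (four_dvd_finrank_of_cmTypeRank_eq_three Φ hr)

/-- **Rank-`3` CM types of a CM field of degree `> 4` are NOT primitive** (they are induced from the quartic core, a
strict subfield; Streng: primitive ⟺ not induced from a strict subfield). [cite: Shimura1998, §8.2 Prop. 26]
[cite: Streng2010, Ch. I Def. 3.2 and (3.6)] [cite: Ribet1980, §3 (3.5)] -/
theorem not_isPrimitive_of_cmTypeRank_eq_three (hK : 4 < finrank ℚ K) (Φ : CMType K) (φ₀ : K →+* ℂ)
    (hr : cmTypeRank Φ = 3) : ¬ IsPrimitive (ℂ ≃+* ℂ) Φ.1 φ₀ := by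
  rw [← not_exists_inducedCMType_iff_isPrimitive, not_not]
  obtain ⟨K₁, Φ₁, h4, hΦ, -⟩ := exists_quartic_isNondegenerate_of_cmTypeRank_eq_three Φ hr
  refine ⟨K₁, Φ₁, fun htop => ?_, hΦ⟩
  rw [htop, IntermediateField.finrank_top'] at h4
  omega

/-- **The abelian varieties of a rank-`3` CM type of a CM field of degree `> 4` are NOT simple** (they are isogenous
to `S^{[K:ℚ]/4}`, `S` a simple CM abelian surface of the quartic core type; simple ⟺ primitive, Shimura).
[cite: Shimura1998, §8.2 Prop. 26] [cite: Ribet1980, §3 (3.5)] -/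
theorem not_isSimple_of_cmTypeRank_eq_three (hK : 4 < finrank ℚ K) (Φ : CMType K)
    (hA : IsCMTypeRealisation Φ A ι θ) (hr : cmTypeRank Φ = 3) : ¬ A.IsSimple := fun hs => by
  obtain ⟨φ₀⟩ : Nonempty (K →+* ℂ) := inferInstance
  exact not_isPrimitive_of_cmTypeRank_eq_three hK Φ φ₀ hr ((isSimple_iff_isPrimitive hA φ₀).1 hs)

/-- **A SIMPLE abelian variety of a rank-`3` CM type is a surface**: `[K:ℚ] = 4`. [cite: Shimura1998, §8.2 Prop. 26]
[cite: Ribet1980, §3 (3.5) and Examples (3.7)] -/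
theorem finrank_eq_four_of_isSimple_of_cmTypeRank_eq_three (Φ : CMType K) (hA : IsCMTypeRealisation Φ A ι θ)
    (hs : A.IsSimple) (hr : cmTypeRank Φ = 3) : finrank ℚ K = 4 := by
  have h4 := four_le_finrank_of_cmTypeRank_eq_three Φ hr
  by_contra hne
  exact not_isSimple_of_cmTypeRank_eq_three (lt_of_le_of_ne h4 (Ne.symm hne)) Φ hA hr hs

/-- **`A` simple ⟹ `Rank(Φ) = 3` iff `K` is QUARTIC** (a simple CM abelian surface: quartic primitive types are
nondegenerate of rank `3`, Streng Lemma 3.5 / the prime-dimension theorem for `g = 2`).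
[cite: Streng2010, Ch. I Lemma 3.4–3.5] [cite: Ribet1980, §3 (3.5) and Examples (3.7)] [cite: Shimura1998, §8.2 Prop. 26] -/
theorem cmTypeRank_eq_three_iff_finrank_eq_four_of_isSimple (Φ : CMType K) (hA : IsCMTypeRealisation Φ A ι θ)
    (hs : A.IsSimple) : cmTypeRank Φ = 3 ↔ finrank ℚ K = 4 := by
  refine ⟨finrank_eq_four_of_isSimple_of_cmTypeRank_eq_three Φ hA hs, fun h4 => ?_⟩
  obtain ⟨φ₀⟩ : Nonempty (K →+* ℂ) := inferInstance
  have hnd := isNondegenerate_of_isPrimitive_of_prime Nat.prime_two (by rw [h4]) φ₀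
    ((isSimple_iff_isPrimitive hA φ₀).1 hs)
  rw [(isNondegenerate_iff Φ).1 hnd, h4]

end Structure

/-! ## §2 Rank `3` ⟹ `Bᵐ(Aⁿ) ⊗ ℂ = Dᵐ(Aⁿ) ⊗ ℂ` and the Hodge conjecture for every power, over any CM field -/

section Hodge

/-- **`Rank(Φ) = 3` ⟹ `Bᵐ(Aⁿ) ⊗ ℂ = Dᵐ(Aⁿ) ⊗ ℂ` FOR ALL `n, m`**, for EVERY realisation `(A, ι, θ)` of `Φ` over ANY CM
field `K`: the quartic core `(K₁, Φ₁)` is nondegenerate and Pohlmann–Hazama transfers along `Φ = Φ₁^K`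
(`A ∼ S^h` up to isogeny). [cite: Gordon1999HodgeAVSurvey, Thm. 6.4 and §9.3] [cite: Pohlmann1968, Thm. 1]
[cite: Ribet1980, §3 (3.4)–(3.5)] -/
theorem hodgeClassSpan_pow_eq_divisorClassesSpan_of_cmTypeRank_eq_three (Φ : CMType K) (hr : cmTypeRank Φ = 3)
    (hA : IsCMTypeRealisation Φ A ι θ) (n m : ℕ) :
    hodgeClassSpan (⨁ fun _ : Fin n => A).dim (⨁ fun _ : Fin n => A).X m =
      divisorClassesSpan (⨁ fun _ : Fin n => A).X (⨁ fun _ : Fin n => A).dim m := by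
  obtain ⟨K₁, Φ₁, -, hΦ, hnd⟩ := exists_quartic_isNondegenerate_of_cmTypeRank_eq_three Φ hr
  haveI : IsCMField K₁ := isCMField_of_cmType_intermediateField K₁ Φ₁
  exact hnd.hodgeClassSpan_pow_eq_divisorClassesSpan_inducedCMType hΦ hA n m

omit [IsCMField K] in
/-- `Bᵐ ⊗ ℂ = Dᵐ ⊗ ℂ` for all `m` on an abelian variety gives the Hodge conjecture for it (Lefschetz `(1,1)` and cup
products, tree theorems). [cite: Gordon1999HodgeAVSurvey, §9.3] -/
private theorem hodgeConjectureFor_of_forall_hodgeClassSpan_eq₃ (B : AbelianVariety ℂ)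
    (h : ∀ m : ℕ, hodgeClassSpan B.dim B.X m = divisorClassesSpan B.X B.dim m) : HodgeConjectureFor B.dim B.X :=
  ⟨nonempty_hodgeModel_holds (Motives.AbelianVariety.isSmoothProjective_holds (A := B)),
    fun m _ hc hmm => AbelianVariety.divisorClassesSpan_le_algebraicClasses B
      (fun b hb hb' => lefschetzOneOne_rational_holds (Motives.AbelianVariety.isSmoothProjective_holds (A := B)) b hb hb')
      m ((h m) ▸ Submodule.subset_span ⟨hc, hmm⟩)⟩

/-- **THE HODGE CONJECTURE FOR EVERY POWER OF EVERY ABELIAN VARIETY WHOSE CM TYPE HAS RANK `3`** — any CM field `K`,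
any realisation `(A, ι, θ)` of a CM type `Φ` with `Rank(Φ) = 3` (the abelian varieties isogenous to a power of a
simple CM abelian surface, through a CM type): `HodgeConjectureFor` holds for `Aⁿ = ⨁_{i<n} A`, every `n`.
[cite: Gordon1999HodgeAVSurvey, Thm. 6.4 and §9.3] [cite: Ribet1980, §3 (3.4)–(3.5) and Examples (3.7)] -/
theorem hodgeConjectureFor_pow_of_cmTypeRank_eq_three (Φ : CMType K) (hr : cmTypeRank Φ = 3)
    (hA : IsCMTypeRealisation Φ A ι θ) (n : ℕ) :
    HodgeConjectureFor (⨁ fun _ : Fin n => A).dim (⨁ fun _ : Fin n => A).X :=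
  hodgeConjectureFor_of_forall_hodgeClassSpan_eq₃ _
    (fun m => hodgeClassSpan_pow_eq_divisorClassesSpan_of_cmTypeRank_eq_three Φ hr hA n m)

/-- **Every Hodge class on every power of an abelian variety of a rank-`3` CM type is algebraic.**
[cite: Gordon1999HodgeAVSurvey, Thm. 6.4 and §9.3] -/
theorem hodgeClasses_algebraic_pow_of_cmTypeRank_eq_three (Φ : CMType K) (hr : cmTypeRank Φ = 3)
    (hA : IsCMTypeRealisation Φ A ι θ) (n m : ℕ) (c : complexBetti (⨁ fun _ : Fin n => A).X (2 * m))
    (hcQ : IsRationalClass c) (hcH : IsOfHodgeType (⨁ fun _ : Fin n => A).dim (⨁ fun _ : Fin n => A).X (2 * m) m m c) :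
    c ∈ algebraicClasses (⨁ fun _ : Fin n => A).X m :=
  (hodgeConjectureFor_pow_of_cmTypeRank_eq_three Φ hr hA n).2 m c hcQ hcH

/-- **No power of an abelian variety of a rank-`3` CM type carries an exceptional Hodge class.**
[cite: Gordon1999HodgeAVSurvey, Thm. 6.4 and §9.3] -/
theorem not_exists_exceptional_pow_of_cmTypeRank_eq_three (Φ : CMType K) (hr : cmTypeRank Φ = 3)
    (hA : IsCMTypeRealisation Φ A ι θ) (n m : ℕ) :
    ¬ ∃ c : complexBetti (⨁ fun _ : Fin n => A).X (2 * m), IsRationalClass c ∧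
        IsOfHodgeType (⨁ fun _ : Fin n => A).dim (⨁ fun _ : Fin n => A).X (2 * m) m m c ∧
        c ∉ divisorClassesSpan (⨁ fun _ : Fin n => A).X (⨁ fun _ : Fin n => A).dim m := by
  rintro ⟨c, hcQ, hcH, hcD⟩
  exact hcD ((hodgeClassSpan_pow_eq_divisorClassesSpan_of_cmTypeRank_eq_three Φ hr hA n m) ▸
    Submodule.subset_span ⟨hcQ, hcH⟩)

/-- **`Rank(Φ) ≤ 3` ⟹ `Bᵐ(Aⁿ) ⊗ ℂ = Dᵐ(Aⁿ) ⊗ ℂ` for all `n, m`** (rank `2`: tree `CMTypeRankTwo`; rank `3`: §2; the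
rank is always `≥ 2`). [cite: Gordon1999HodgeAVSurvey, Thm. 6.4 and §9.3] [cite: Ribet1980, §3 (3.4)–(3.5)] -/
theorem hodgeClassSpan_pow_eq_divisorClassesSpan_of_cmTypeRank_le_three (Φ : CMType K) (hr : cmTypeRank Φ ≤ 3)
    (hA : IsCMTypeRealisation Φ A ι θ) (n m : ℕ) :
    hodgeClassSpan (⨁ fun _ : Fin n => A).dim (⨁ fun _ : Fin n => A).X m =
      divisorClassesSpan (⨁ fun _ : Fin n => A).X (⨁ fun _ : Fin n => A).dim m := by
  have h2 := two_le_cmTypeRank_complex Φ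
  rcases Nat.lt_or_ge (cmTypeRank Φ) 3 with hlt | hge
  · exact hodgeClassSpan_pow_eq_divisorClassesSpan_of_cmTypeRank_eq_two Φ (by omega) hA n m
  · exact hodgeClassSpan_pow_eq_divisorClassesSpan_of_cmTypeRank_eq_three Φ (le_antisymm hr hge) hA n m

/-- **THE HODGE CONJECTURE FOR EVERY POWER OF EVERY ABELIAN VARIETY WHOSE CM TYPE HAS RANK `≤ 3`** (any CM field, any
realisation; the Mumford–Tate group has dimension `≤ 3`).  Rank `4` is the first rank with exceptional Hodge classes
(Mumford–Pohlmann's degenerate octic types). [cite: Gordon1999HodgeAVSurvey, Thm. 6.4 and §9.3]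
[cite: Ribet1980, §3 (3.4)–(3.5) and Examples (3.7)] [cite: Pohlmann1968, Thm. 1 and §3] -/
theorem hodgeConjectureFor_pow_of_cmTypeRank_le_three (Φ : CMType K) (hr : cmTypeRank Φ ≤ 3)
    (hA : IsCMTypeRealisation Φ A ι θ) (n : ℕ) :
    HodgeConjectureFor (⨁ fun _ : Fin n => A).dim (⨁ fun _ : Fin n => A).X :=
  hodgeConjectureFor_of_forall_hodgeClassSpan_eq₃ _
    (fun m => hodgeClassSpan_pow_eq_divisorClassesSpan_of_cmTypeRank_le_three Φ hr hA n m)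

/-- **Reflex degree `4` ⟹ the Hodge conjecture for all powers** (`[K* : ℚ] = 4 ⟺ Rank(Φ) = 3`, tree
`cmTypeRank_eq_three_iff_finrank_traceField_eq_four`; `[K* : ℚ] = 2` is the rank-`2` case). [cite: Ribet1980, §3 (3.4)–(3.5)]
[cite: Gordon1999HodgeAVSurvey, Thm. 6.4 and §9.3] -/
theorem hodgeConjectureFor_pow_of_finrank_traceField_eq_four (Φ : CMType K) (h4 : finrank ℚ (traceField Φ) = 4)
    (hA : IsCMTypeRealisation Φ A ι θ) (n : ℕ) :
    HodgeConjectureFor (⨁ fun _ : Fin n => A).dim (⨁ fun _ : Fin n => A).X :=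
  hodgeConjectureFor_pow_of_cmTypeRank_eq_three Φ ((cmTypeRank_eq_three_iff_finrank_traceField_eq_four Φ).2 h4) hA n

end Hodge

end Literature.AlgebraicGeometry.Pohlmann1968
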